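import Mathlib
import Summits.NavierStokesRegularity.NavierStokesRegularity.Theorems.FilamentSkeletonRssStadiumPairPositivity
import Summits.NavierStokesRegularity.NavierStokesRegularity.Theorems.FilamentSkeletonRssStadiumPairAveraging

/-!
# Route `FilamentSkeletonRss` · child crux `TangentSkeletonNearStraightL` (stmt-NavierStokesRegularity-23320) · registered line
# `child_tangent_analytic_strip_L` (b0b56c52900dd90a), stub `stub_stripPropagation` — brick: SEGMENT POSITIVITY WITH DEVIATION PROFILES

`Theorems.StadiumSegmentPositivity.segment_mean_sq_bounds` (p-landed, used by `Theorems.StadiumContourPositivity` and hence by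
`Theorems.StadiumStripCore.strip_core`) bounds the mean-tangent square `P = Σᵢ (∫₀¹ F′ᵢ(z + r s) dr)²` of a stadium-analytic filament through
CONSTANT radii: real tangent oscillation `ρ`, real-part deviation `≤ e`, imaginary part `≤ q` uniformly along the segment.  Near the ends of the
registered quarter-width stadium the deviations are far from uniform along a segment (disc ratio `3` at the output corner, `4` a quarter-width
in: `E = 0.50` vs `0.26`), and the sup form loses the corner (`(Rb+2E)²/2 = 1.12 > 1` at `Rb = 1/2`).  This file is the PROFILE form: the same
conclusion with continuous pointwise profiles `e(r)`, `q(r)`,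
  `Re P ≥ 1 − ∫₀¹∫₀¹ (ρ + e(r) + e(r′))²/2`,   `|Im P| ≤ ∫₀¹∫₀¹ (q(r) + q(r′))·(ρ + e(r) + e(r′))`
(`segment_mean_sq_bounds_profile`), and the chord consequence for a displacement with `Re(s²) ≥ 0`
  `Re Σᵢ (Fᵢ(z+s) − Fᵢ(z))² ≥ Re(s²)·(1 − ∫∫(ρ+e+e′)²/2) − |Im(s²)|·∫∫(q+q′)(ρ+e+e′)`   (`segment_chord_re_ge_profile`),
assembled from the pointwise pair estimates `Theorems.StadiumPairPositivity.re_dot_ge_of_le` / `abs_im_dot_le_of_le` and the pair-averaging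
principle `Theorems.StadiumPairAveraging.sum_sq_mean_re_im_of_pairwise`.  With the landed pointwise deviation tools
(`Theorems.StadiumDeviationRatio.deviation_ratio`, disc ratio varying along the segment) this is the form in which a horizontal plateau through
the registered output corner is tested (numbers in the hand's census: left plateau of length `hs/4` from the corner, `Rb = 1/2`:
`∫∫(ρ+e+e′)²/2 = 0.75 < 1`, where the sup form gives `1.12`; the short chords from the corner, where the double mean tends to the sup, are the
province of the second-order form `Theorems.StadiumChordVariance`).

HONEST FRAMING: elementary bricks for a plan about a HYPOTHETICAL filament skeleton on the NEGATIVE side of a MODEL route; the stub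
`stub_stripPropagation` is NOT closed by this file; nothing here bears on Navier–Stokes regularity or blow-up.
`--supports stmt-NavierStokesRegularity-23320`.
-/

set_option linter.dupNamespace false

noncomputable section

namespace Summit.NavierStokesRegularity.NavierStokesRegularity.Theorems.StadiumSegmentProfile

open Set MeasureTheory
open scoped BigOperators
open Summit.NavierStokesRegularity.NavierStokesRegularity.Theorems.StadiumPairPositivity
open Summit.NavierStokesRegularity.NavierStokesRegularity.Theorems.StadiumPairAveraging

/-- **Segment positivity with deviation profiles (the `P`-level statement).**  `U` open, `F` differentiable on `U` with `∑ (F′)ᵢ² = 1`, the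
segment `r ↦ z + r·s`, `r ∈ [0,1]`, inside `U`; a real unit tangent field `T` along it with oscillation `≤ ρ`; CONTINUOUS profiles `e`, `q` with
real-part deviation `≤ e(r)` and imaginary part `≤ q(r)` at the point of parameter `r`.  Then `P = ∑ᵢ (∫₀¹ F′ᵢ(z+rs) dr)²` has
`Re P ≥ 1 − ∫₀¹∫₀¹ (ρ + e(r) + e(r′))²/2` and `|Im P| ≤ ∫₀¹∫₀¹ (q(r)+q(r′))(ρ + e(r) + e(r′))`. [folklore] -/
theorem segment_mean_sq_bounds_profile {U : Set ℂ} (hU : IsOpen U) {F : ℂ → (Fin 3 → ℂ)} (hF : DifferentiableOn ℂ F U)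
    (hunit : ∀ w ∈ U, ∑ i, (deriv F w i) ^ 2 = 1) {z s : ℂ} (hseg : ∀ r ∈ Icc (0:ℝ) 1, z + (r : ℂ) * s ∈ U)
    (T : ℝ → Fin 3 → ℝ) (hT : ∀ r ∈ Icc (0:ℝ) 1, ∑ i, T r i ^ 2 = 1) {ρ : ℝ} {e q : ℝ → ℝ}
    (hec : Continuous e) (hqc : Continuous q)
    (hρ : ∀ r ∈ Icc (0:ℝ) 1, ∀ r' ∈ Icc (0:ℝ) 1, √(∑ i, (T r i - T r' i) ^ 2) ≤ ρ)
    (he : ∀ r ∈ Icc (0:ℝ) 1, √(∑ i, ((deriv F (z + (r : ℂ) * s) i).re - T r i) ^ 2) ≤ e r)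
    (hq : ∀ r ∈ Icc (0:ℝ) 1, √(∑ i, (deriv F (z + (r : ℂ) * s) i).im ^ 2) ≤ q r) :
    1 - (∫ r in (0:ℝ)..1, ∫ r' in (0:ℝ)..1, (ρ + e r + e r') ^ 2 / 2) ≤
        (∑ i, (∫ r in (0:ℝ)..1, deriv F (z + (r : ℂ) * s) i) ^ 2).re ∧
      |(∑ i, (∫ r in (0:ℝ)..1, deriv F (z + (r : ℂ) * s) i) ^ 2).im| ≤
        ∫ r in (0:ℝ)..1, ∫ r' in (0:ℝ)..1, (q r + q r') * (ρ + e r + e r') := by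
  obtain ⟨ha, -⟩ := chord_eq_mul_mean_deriv hU hF hseg
  have hφc : Continuous (Function.uncurry fun r r' : ℝ => (ρ + e r + e r') ^ 2 / 2) := by
    have h1 : Continuous fun p : ℝ × ℝ => (ρ + e p.1 + e p.2) ^ 2 / 2 :=
      ((continuous_const.add (hec.comp continuous_fst)).add (hec.comp continuous_snd)).pow 2 |>.div_const 2
    exact h1
  have hψc : Continuous (Function.uncurry fun r r' : ℝ => (q r + q r') * (ρ + e r + e r')) := by
    have h1 : Continuous fun p : ℝ × ℝ => (q p.1 + q p.2) * (ρ + e p.1 + e p.2) :=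
      ((hqc.comp continuous_fst).add (hqc.comp continuous_snd)).mul
        ((continuous_const.add (hec.comp continuous_fst)).add (hec.comp continuous_snd))
    exact h1
  have hpairφ : ∀ r ∈ Icc (0:ℝ) 1, ∀ r' ∈ Icc (0:ℝ) 1,
      1 - (ρ + e r + e r') ^ 2 / 2 ≤ (∑ i, deriv F (z + (r : ℂ) * s) i * deriv F (z + (r' : ℂ) * s) i).re := by
    intro r hr r' hr'
    exact re_dot_ge_of_le _ _ (T r) (T r') (hunit _ (hseg r hr)) (hunit _ (hseg r' hr')) (hT r hr) (hT r' hr')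
      (hρ r hr r' hr') (he r hr) (he r' hr')
  have hpairψ : ∀ r ∈ Icc (0:ℝ) 1, ∀ r' ∈ Icc (0:ℝ) 1,
      |(∑ i, deriv F (z + (r : ℂ) * s) i * deriv F (z + (r' : ℂ) * s) i).im| ≤ (q r + q r') * (ρ + e r + e r') := by
    intro r hr r' hr'
    exact abs_im_dot_le_of_le _ _ (T r) (T r') (hunit _ (hseg r hr)) (hunit _ (hseg r' hr'))
      (hρ r hr r' hr') (he r hr) (he r' hr') (hq r hr) (hq r' hr')
  exact sum_sq_mean_re_im_of_pairwise ha hφc hψc hpairφ hpairψ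

/-- **Complexified-chord positivity with deviation profiles.**  Under the hypotheses of `segment_mean_sq_bounds_profile` and for a displacement
with `0 ≤ Re(s²)`:
`Re(s²)·(1 − ∫₀¹∫₀¹ (ρ+e(r)+e(r′))²/2) − |Im(s²)|·∫₀¹∫₀¹ (q(r)+q(r′))(ρ+e(r)+e(r′)) ≤ Re Σᵢ (Fᵢ(z+s) − Fᵢ(z))²`. [folklore] -/
theorem segment_chord_re_ge_profile {U : Set ℂ} (hU : IsOpen U) {F : ℂ → (Fin 3 → ℂ)} (hF : DifferentiableOn ℂ F U)
    (hunit : ∀ w ∈ U, ∑ i, (deriv F w i) ^ 2 = 1) {z s : ℂ} (hseg : ∀ r ∈ Icc (0:ℝ) 1, z + (r : ℂ) * s ∈ U)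
    (T : ℝ → Fin 3 → ℝ) (hT : ∀ r ∈ Icc (0:ℝ) 1, ∑ i, T r i ^ 2 = 1) {ρ : ℝ} {e q : ℝ → ℝ}
    (hec : Continuous e) (hqc : Continuous q)
    (hρ : ∀ r ∈ Icc (0:ℝ) 1, ∀ r' ∈ Icc (0:ℝ) 1, √(∑ i, (T r i - T r' i) ^ 2) ≤ ρ)
    (he : ∀ r ∈ Icc (0:ℝ) 1, √(∑ i, ((deriv F (z + (r : ℂ) * s) i).re - T r i) ^ 2) ≤ e r)
    (hq : ∀ r ∈ Icc (0:ℝ) 1, √(∑ i, (deriv F (z + (r : ℂ) * s) i).im ^ 2) ≤ q r)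
    (hs : 0 ≤ (s ^ 2).re) :
    (s ^ 2).re * (1 - ∫ r in (0:ℝ)..1, ∫ r' in (0:ℝ)..1, (ρ + e r + e r') ^ 2 / 2) -
        |(s ^ 2).im| * (∫ r in (0:ℝ)..1, ∫ r' in (0:ℝ)..1, (q r + q r') * (ρ + e r + e r')) ≤
      (∑ i, (F (z + s) i - F z i) ^ 2).re := by
  have hφc : Continuous (Function.uncurry fun r r' : ℝ => (ρ + e r + e r') ^ 2 / 2) := by
    have h1 : Continuous fun p : ℝ × ℝ => (ρ + e p.1 + e p.2) ^ 2 / 2 :=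
      ((continuous_const.add (hec.comp continuous_fst)).add (hec.comp continuous_snd)).pow 2 |>.div_const 2
    exact h1
  have hψc : Continuous (Function.uncurry fun r r' : ℝ => (q r + q r') * (ρ + e r + e r')) := by
    have h1 : Continuous fun p : ℝ × ℝ => (q p.1 + q p.2) * (ρ + e p.1 + e p.2) :=
      ((hqc.comp continuous_fst).add (hqc.comp continuous_snd)).mul
        ((continuous_const.add (hec.comp continuous_fst)).add (hec.comp continuous_snd))
    exact h1
  have hpairφ : ∀ r ∈ Icc (0:ℝ) 1, ∀ r' ∈ Icc (0:ℝ) 1,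
      1 - (ρ + e r + e r') ^ 2 / 2 ≤ (∑ i, deriv F (z + (r : ℂ) * s) i * deriv F (z + (r' : ℂ) * s) i).re := by
    intro r hr r' hr'
    exact re_dot_ge_of_le _ _ (T r) (T r') (hunit _ (hseg r hr)) (hunit _ (hseg r' hr')) (hT r hr) (hT r' hr')
      (hρ r hr r' hr') (he r hr) (he r' hr')
  have hpairψ : ∀ r ∈ Icc (0:ℝ) 1, ∀ r' ∈ Icc (0:ℝ) 1,
      |(∑ i, deriv F (z + (r : ℂ) * s) i * deriv F (z + (r' : ℂ) * s) i).im| ≤ (q r + q r') * (ρ + e r + e r') := by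
    intro r hr r' hr'
    exact abs_im_dot_le_of_le _ _ (T r) (T r') (hunit _ (hseg r hr)) (hunit _ (hseg r' hr'))
      (hρ r hr r' hr') (he r hr) (he r' hr') (hq r hr) (hq r' hr')
  exact chord_sq_re_ge_of_pairwise hU hF hseg hφc hψc hpairφ hpairψ hs

/-- **Horizontal plateau with a real-deviation profile.**  For a REAL displacement `s` (horizontal segment) the imaginary profile drops out:
`s²·(1 − ∫₀¹∫₀¹ (ρ + e(r) + e(r′))²/2) ≤ Re Σᵢ (Fᵢ(z+s) − Fᵢ(z))²`; in particular the chord is on the principal branch as soon as the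
DOUBLE MEAN of `(ρ + e(r) + e(r′))²/2` is `< 1` — not its supremum. [folklore] -/
theorem horizontal_chord_re_ge_profile {U : Set ℂ} (hU : IsOpen U) {F : ℂ → (Fin 3 → ℂ)} (hF : DifferentiableOn ℂ F U)
    (hunit : ∀ w ∈ U, ∑ i, (deriv F w i) ^ 2 = 1) {z : ℂ} {s : ℝ} (hseg : ∀ r ∈ Icc (0:ℝ) 1, z + (r : ℂ) * (s : ℂ) ∈ U)
    (T : ℝ → Fin 3 → ℝ) (hT : ∀ r ∈ Icc (0:ℝ) 1, ∑ i, T r i ^ 2 = 1) {ρ : ℝ} {e : ℝ → ℝ} (hec : Continuous e)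
    (hρ : ∀ r ∈ Icc (0:ℝ) 1, ∀ r' ∈ Icc (0:ℝ) 1, √(∑ i, (T r i - T r' i) ^ 2) ≤ ρ)
    (he : ∀ r ∈ Icc (0:ℝ) 1, √(∑ i, ((deriv F (z + (r : ℂ) * (s : ℂ)) i).re - T r i) ^ 2) ≤ e r) :
    s ^ 2 * (1 - ∫ r in (0:ℝ)..1, ∫ r' in (0:ℝ)..1, (ρ + e r + e r') ^ 2 / 2) ≤
      (∑ i, (F (z + (s : ℂ)) i - F z i) ^ 2).re := by
  -- for real `s`, `Im(s²) = 0`, so ANY continuous imaginary profile works: take the actual Euclidean imaginary size along the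
  -- segment, made continuous on `ℝ` by clamping the parameter to `[0,1]`.
  have hdcont : ContinuousOn (deriv F) U := ((hF.analyticOnNhd hU).deriv).continuousOn
  have hpath : Continuous fun r : ℝ => z + (r : ℂ) * (s : ℂ) :=
    continuous_const.add (Complex.continuous_ofReal.mul continuous_const)
  set qf : ℝ → ℝ := fun r => √(∑ i, (deriv F (z + ((max 0 (min r 1) : ℝ) : ℂ) * (s : ℂ)) i).im ^ 2) with hqf
  have hclamp : Continuous fun r : ℝ => max 0 (min r 1) := continuous_const.max (continuous_id.min continuous_const)
  have hclamp_mem : ∀ r : ℝ, max 0 (min r 1) ∈ Icc (0:ℝ) 1 := fun r =>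
    ⟨le_max_left _ _, max_le zero_le_one (min_le_right _ _)⟩
  have hqc : Continuous qf := by
    have h1 : Continuous fun r : ℝ => deriv F (z + ((max 0 (min r 1) : ℝ) : ℂ) * (s : ℂ)) := by
      have hin : ∀ r : ℝ, z + ((max 0 (min r 1) : ℝ) : ℂ) * (s : ℂ) ∈ U := fun r => hseg _ (hclamp_mem r)
      have h2 : Continuous fun r : ℝ => z + ((max 0 (min r 1) : ℝ) : ℂ) * (s : ℂ) :=
        continuous_const.add ((Complex.continuous_ofReal.comp hclamp).mul continuous_const)
      exact hdcont.comp_continuous h2 hin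
    refine Real.continuous_sqrt.comp ?_
    refine continuous_finsetSum _ fun i _ => ?_
    exact ((Complex.continuous_im.comp ((continuous_apply i).comp h1)).pow 2)
  have hq : ∀ r ∈ Icc (0:ℝ) 1, √(∑ i, (deriv F (z + (r : ℂ) * (s : ℂ)) i).im ^ 2) ≤ qf r := by
    intro r hr
    have hr' : max 0 (min r 1) = r := by
      rw [min_eq_left hr.2, max_eq_right hr.1]
    simp only [hqf, hr']
    exact le_rfl
  have hs2 : 0 ≤ (((s : ℂ)) ^ 2).re := by
    rw [← Complex.ofReal_pow, Complex.ofReal_re]; positivity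
  have h := segment_chord_re_ge_profile hU hF hunit hseg T hT hec hqc hρ he hq hs2
  have him : (((s : ℂ)) ^ 2).im = 0 := by rw [← Complex.ofReal_pow, Complex.ofReal_im]
  have hre : (((s : ℂ)) ^ 2).re = s ^ 2 := by rw [← Complex.ofReal_pow, Complex.ofReal_re]
  rw [him, hre, abs_zero, zero_mul, sub_zero] at h
  exact h

end Summit.NavierStokesRegularity.NavierStokesRegularity.Theorems.StadiumSegmentProfile

end
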